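import Literature.Computability.AlgebraicComplexity.AlgebraicExtensionDecompositionCertificate
import HarnessLib

/-!
# Order-one approximate decompositions over an algebraic extension — a kernel-decidable certificate

(tool; companion of `AlgebraicExtensionDecompositionCertificate.lean` and
`ApproxDecompositionCertificate.lean`)

An ORDER-ONE approximate decomposition (Bläser 2013, Def. 6.1(1) with `h = 1`) of `D · T` by `r`
triads whose entries are LINEAR in `ε` with coefficients in the number ring `ℤ[z]/(F)`,
`u_ρ = u⁰_ρ + ε u¹_ρ`, `v_ρ = v⁰_ρ + ε v¹_ρ`, `w_ρ = w⁰_ρ + ε w¹_ρ`,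
`∑_ρ u_ρ ⊗ v_ρ ⊗ w_ρ = ε · (D · T) + O(ε²)`, amounts to two families of congruences modulo `F`:

* (degree `0`) `∑_ρ u⁰_ρ,i · v⁰_ρ,j · w⁰_ρ,l ≡ 0`,
* (degree `1`) `∑_ρ (u¹_ρ,i v⁰_ρ,j w⁰_ρ,l + u⁰_ρ,i v¹_ρ,j w⁰_ρ,l + u⁰_ρ,i v⁰_ρ,j w¹_ρ,l) ≡ D · T_ijl`,

and BOTH are instances of the exact certificate `AlgExtCert.check` of the companion file: the first
is the check of an `r`-term decomposition of the ZERO tensor, the second the check of an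
`(r + r + r)`-term decomposition of `D · T` by the triads `(u¹,v⁰,w⁰)`, `(u⁰,v¹,w⁰)`, `(u⁰,v⁰,w¹)`
(assembled with `Fin.append`).  So

* `AlgExtCert.checkOrderOne a b c r F D T U₀ U₁ V₀ V₁ W₀ W₁ Q₀ Q₁ : Bool` is the conjunction of two
  calls of `AlgExtCert.check` with explicit quotients `Q₀`, `Q₁` (division-free, `decide +kernel`);
* `AlgExtCert.isApproxDecomposition_of_checkOrderOne` — at any root `θ` of `F` in a commutative ring
  `K`, a successful check IS an order-`1` approximate decomposition of `D · T` over `K[ε]` by the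
  triads `C (U₀ ρ i)(θ) + C (U₁ ρ i)(θ) · ε`, … (the companion's `sum_eval_eq_of_check` twice, plus
  the coefficients of a product of three linear polynomials, `coeff_linearTriple`);
* `AlgExtCert.approxRank_one_le_of_checkOrderOne`, `algBorderRank_le_of_checkOrderOne` —
  `R_1(T ⊗ K) ≤ r` and `bR(T ⊗ K) ≤ r` when moreover `D` is a unit of `K`
  (via `ApproxCert.approxRank_le_of_isApproxDecomposition_mul` and `bR ≤ R_1`);
* a worked `2 × 2 × 2` example (`AlgExtCert.wTensor`, Bläser 2013 §6: multiplication of linear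
  polynomials mod `X²`, rank `3`, border rank `2`): the tensor
  `a⊗a⊗b + a⊗b⊗a + b⊗a⊗a = (d/dε)|₀ (a + εb)^{⊗3}` has `bR ≤ 2` by the order-one decomposition
  `(a + εb)^{⊗3} - a^{⊗3} = ε · T + O(ε²)` (here `F` plays no role: any `F`, `Q₀ = Q₁ = 0`).

USE: the border-rank tables of the pub-tensor bundle contain `4 × 4 × 4` tensors whose best upper
certificate is an order-one decomposition over `ℚ(i)`; the integer format `ApproxCert.check` cannot
hold `i` and the exact format `AlgExtCert.check` cannot hold `ε` (`SmallTensorBorderRankAlgExtOrderOne.lean`).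
Higher orders `h ≥ 2` would take coefficient lists in `ℤ[z][ε]`; not needed by the current tables.

HONEST FRAMING (pub-tensor bundle, unit b2b-tensor-1): a certificate-checking TOOL for certified
table entries about explicit small tensors; it proves nothing about the exponent of matrix
multiplication.

## References

* [Blaser2013] M. Bläser, *Fast Matrix Multiplication*, Theory of Computing Library, Graduate
  Surveys 5 (2013) — §6 (introductory example), Def. 6.1 (`R_h`, approximate decompositions over
  `K[ε]`), Rem. 6.2 (`R_0 = R ≥ R_1 ≥ ⋯ = bR`).
* [BurgisserClausenShokrollahi1997] P. Bürgisser, M. Clausen, M. A. Shokrollahi, *Algebraic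
  Complexity Theory*, Springer 1997 — §14.1 (rank and the ground field), §15.4 (degeneration and
  border rank).
-/

noncomputable section

open scoped BigOperators Polynomial
open Polynomial

namespace Literature.Computability.AlgebraicComplexity

namespace AlgExtCert

/-! ## The certificate check -/

/-- **Order-one check** over `ℤ[z]/(F)`: the degree-`0` congruences
`∑_ρ U₀ V₀ W₀ ≡ 0 (mod F)` (an exact `r`-term "decomposition of `0`", quotients `Q₀`) and the
degree-`1` congruences `∑_ρ (U₁V₀W₀ + U₀V₁W₀ + U₀V₀W₁) ≡ D · T (mod F)` (an exact `(r+r+r)`-term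
decomposition of `D · T`, quotients `Q₁`), both delegated to `AlgExtCert.check`.
[cite: Blaser2013, Def. 6.1] -/
def checkOrderOne (a b c r : ℕ) (F : List ℤ) (D : ℤ) (T : Fin a → Fin b → Fin c → ℤ)
    (U₀ U₁ : Fin r → Fin a → List ℤ) (V₀ V₁ : Fin r → Fin b → List ℤ)
    (W₀ W₁ : Fin r → Fin c → List ℤ) (Q₀ Q₁ : Fin a → Fin b → Fin c → List ℤ) : Bool :=
  check a b c r F D (fun _ _ _ => 0) U₀ V₀ W₀ Q₀ &&
    check a b c (r + r + r) F D T (Fin.append (Fin.append U₁ U₀) U₀)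
      (Fin.append (Fin.append V₀ V₁) V₀) (Fin.append (Fin.append W₀ W₀) W₁) Q₁

/-! ## Soundness -/

section Sound

variable {K : Type*} [CommRing K]

/-- The coefficients in degrees `≤ 1` of a product of three linear polynomials of `K[ε]`.
[folklore] -/
theorem coeff_linearTriple (a₀ a₁ b₀ b₁ c₀ c₁ : K) (d : ℕ) (hd : d ≤ 1) :
    ((C a₀ + C a₁ * X) * (C b₀ + C b₁ * X) * (C c₀ + C c₁ * X)).coeff d =
      if d = 1 then a₁ * b₀ * c₀ + a₀ * b₁ * c₀ + a₀ * b₀ * c₁ else a₀ * b₀ * c₀ := by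
  have h : (C a₀ + C a₁ * X) * (C b₀ + C b₁ * X) * (C c₀ + C c₁ * X) =
      C (a₀ * b₀ * c₀) + C (a₁ * b₀ * c₀ + a₀ * b₁ * c₀ + a₀ * b₀ * c₁) * X
        + C (a₁ * b₁ * c₀ + a₁ * b₀ * c₁ + a₀ * b₁ * c₁) * X ^ 2 + C (a₁ * b₁ * c₁) * X ^ 3 := by
    simp only [map_add, map_mul]
    ring
  rw [h]
  interval_cases d <;> simp only [coeff_add, coeff_C, coeff_C_mul_X, coeff_C_mul_X_pow] <;> simp

/-- **Soundness.** At a root `θ ∈ K` of `F`, a successful order-one check is an order-`1`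
approximate decomposition of `D · T` with `r` triads over `K[ε]` whose entries are the linear
polynomials `U₀(θ) + U₁(θ)·ε`, `V₀(θ) + V₁(θ)·ε`, `W₀(θ) + W₁(θ)·ε`. [cite: Blaser2013, Def. 6.1] -/
theorem isApproxDecomposition_of_checkOrderOne {a b c r : ℕ} {F : List ℤ} {D : ℤ}
    {T : Fin a → Fin b → Fin c → ℤ} {U₀ U₁ : Fin r → Fin a → List ℤ}
    {V₀ V₁ : Fin r → Fin b → List ℤ} {W₀ W₁ : Fin r → Fin c → List ℤ}
    {Q₀ Q₁ : Fin a → Fin b → Fin c → List ℤ}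
    (hc : checkOrderOne a b c r F D T U₀ U₁ V₀ V₁ W₀ W₁ Q₀ Q₁ = true) {θ : K}
    (hθ : evalL θ F = 0) :
    IsApproxDecomposition 1 (fun i j l => (D : K) * (T i j l : K))
      (fun ρ i => C (evalL θ (U₀ ρ i)) + C (evalL θ (U₁ ρ i)) * X)
      (fun ρ j => C (evalL θ (V₀ ρ j)) + C (evalL θ (V₁ ρ j)) * X)
      (fun ρ l => C (evalL θ (W₀ ρ l)) + C (evalL θ (W₁ ρ l)) * X) := by
  simp only [checkOrderOne, Bool.and_eq_true] at hc
  obtain ⟨hc₀, hc₁⟩ := hc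
  intro i j l d hd
  rw [finsetSum_coeff]
  simp_rw [coeff_linearTriple _ _ _ _ _ _ d hd]
  have h₀ := sum_eval_eq_of_check (K := K) hc₀ hθ i j l
  have h₁ := sum_eval_eq_of_check (K := K) hc₁ hθ i j l
  rw [Fin.sum_univ_add, Fin.sum_univ_add] at h₁
  simp only [Fin.append_left, Fin.append_right] at h₁
  interval_cases d
  · simpa using h₀
  · simp only [if_true, Finset.sum_add_distrib]
    rw [← Int.cast_mul]
    exact h₁

/-- **`R_1(T) ≤ r`** at a root of `F`, over every commutative ring in which the multiplier `D` is a
unit. [cite: Blaser2013, Def. 6.1] -/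
theorem approxRank_one_le_of_checkOrderOne (K : Type*) [CommRing K] {a b c r : ℕ} {F : List ℤ}
    {D : ℤ} {T : Fin a → Fin b → Fin c → ℤ} {U₀ U₁ : Fin r → Fin a → List ℤ}
    {V₀ V₁ : Fin r → Fin b → List ℤ} {W₀ W₁ : Fin r → Fin c → List ℤ}
    {Q₀ Q₁ : Fin a → Fin b → Fin c → List ℤ}
    (hc : checkOrderOne a b c r F D T U₀ U₁ V₀ V₁ W₀ W₁ Q₀ Q₁ = true) {θ : K}
    (hθ : evalL θ F = 0) (hD : IsUnit (D : K)) :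
    approxRank 1 (fun i j l => (T i j l : K)) ≤ r :=
  ApproxCert.approxRank_le_of_isApproxDecomposition_mul hD
    (isApproxDecomposition_of_checkOrderOne hc hθ)

/-- **`bR(T) ≤ r`** at a root of `F`, over every commutative ring in which the multiplier `D` is a
unit (`bR ≤ R_1`). [cite: Blaser2013, Rem. 6.2] -/
theorem algBorderRank_le_of_checkOrderOne (K : Type*) [CommRing K] {a b c r : ℕ} {F : List ℤ}
    {D : ℤ} {T : Fin a → Fin b → Fin c → ℤ} {U₀ U₁ : Fin r → Fin a → List ℤ}
    {V₀ V₁ : Fin r → Fin b → List ℤ} {W₀ W₁ : Fin r → Fin c → List ℤ}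
    {Q₀ Q₁ : Fin a → Fin b → Fin c → List ℤ}
    (hc : checkOrderOne a b c r F D T U₀ U₁ V₀ V₁ W₀ W₁ Q₀ Q₁ = true) {θ : K}
    (hθ : evalL θ F = 0) (hD : IsUnit (D : K)) :
    algBorderRank (fun i j l => (T i j l : K)) ≤ r :=
  (algBorderRank_le_approxRank 1 _).trans (approxRank_one_le_of_checkOrderOne K hc hθ hD)

end Sound

/-! ## A worked example: `a⊗a⊗b + a⊗b⊗a + b⊗a⊗a` -/

/-- The `2 × 2 × 2` tensor `T = e₀⊗e₀⊗e₁ + e₀⊗e₁⊗e₀ + e₁⊗e₀⊗e₀` (the tangent vector to the curve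
`(e₀ + ε e₁)^{⊗3}` of rank-one tensors; rank `3`, border rank `2` — Bläser's introductory example of
§6, the multiplication of linear polynomials modulo `X²`, up to swapping the two slices of the third
factor).
[cite: Blaser2013, §6 (example before Def. 6.1)] -/
def wTensor : Fin 2 → Fin 2 → Fin 2 → ℤ :=
  ApproxCert.ofEntries 2 2 2 [((0, 0, 1), 1), ((0, 1, 0), 1), ((1, 0, 0), 1)]

/-- Order-one certificate `(e₀ + εe₁)^{⊗3} - e₀^{⊗3} = ε · T + O(ε²)` with `r = 2`, `D = 1`, over
`ℤ[z]/(z² + 1)` with `z` unused (`Q₀ = Q₁ = 0`), checked by `decide`.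
[cite: Blaser2013, §6 (example before Def. 6.1)] -/
theorem wTensor_checkOrderOne :
    checkOrderOne 2 2 2 2 [1, 0, 1] 1 wTensor
      ![![[1], []], ![[-1], []]] ![![[], [1]], ![[], []]]
      ![![[1], []], ![[1], []]] ![![[], [1]], ![[], []]]
      ![![[1], []], ![[1], []]] ![![[], [1]], ![[], []]]
      (fun _ _ _ => []) (fun _ _ _ => []) = true := by
  decide +kernel

/-- `bR(T ⊗ K) ≤ 2` for the tangent tensor `T = e₀⊗e₀⊗e₁ + e₀⊗e₁⊗e₀ + e₁⊗e₀⊗e₀`, over every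
commutative ring containing a root of `z² + 1` (the hypothesis is an artefact of the format; take
`K = ℤ[i]` or `ℂ`). [cite: Blaser2013, §6 (example before Def. 6.1)] -/
theorem algBorderRank_wTensor_le (K : Type*) [CommRing K] (θ : K) (hθ : θ ^ 2 + 1 = 0) :
    algBorderRank (fun i j l => ((wTensor i j l : ℤ) : K)) ≤ 2 :=
  algBorderRank_le_of_checkOrderOne K wTensor_checkOrderOne (θ := θ)
    (by simp only [evalL_cons, evalL_nil]; push_cast; linear_combination hθ) (by simp)

end AlgExtCert

end Literature.Computability.AlgebraicComplexity
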